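import Mathlib
import HarnessLib
import Literature.ModelTheory.FiniteModelTheory.StructCkEquiv
import Summits.ValiantsHypothesis.ValiantsHypothesis.Theorems.SymmetryDialBentBijections

/-!
# SymmetryDial — (B) «bent ⇒ C³-blind»: Duplicator's strategy in the `3`-pebble game

Route `SymmetryDial` (workshop `decomp-valiant`, lens 1, gen 8), item 23711 (P′ = `AffinePebblePairs`);
first half of the proof of the typed target (B) `SymmetryDialBent.BentCThreeBlind` (conclusion in
`Theorems/SymmetryDialBentCThree.lean`).  Duplicator's POSITION INVARIANT `Inv` for bent `f, g` with
duals `f̃, g̃`: pebbled pairs are sort-homogeneous and respect equality; a pebbled dual pair `θ ↦ θ'` has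
`f̃ θ = g̃ θ'` and `θ = 0 ↔ θ' = 0`; two pebbled point pairs `a ↦ a'`, `b ↦ b'` have `f(a+b) = g(a'+b')`;
a pebbled dual pair and two pebbled point pairs respect incidence.  Her MOVE (`move_mem`, `strategy`):
on each sort a colour-preserving bijection with prescribed values (`SymmetryDialBentBijections`), chosen
by the sorts of the at most two pebble pairs left on the board.  Instrument calibration only
(LADDER-Valiant rung 0); nothing here bears on VP ≠ VNP.
-/

namespace Summit.ValiantsHypothesis.ValiantsHypothesis.Theorems.SymmetryDialBentGame

open Finset
open Literature.ModelTheory.FiniteModelTheory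
open SymmetryDialAffinePebble (V AffRel Laff pair RelHolds affStr AffinePebbleEquiv)
open SymmetryDialAffinePebbleThree (grpMat)
open SymmetryDialWalsh (sgn walsh wt)
open SymmetryDialBent (IsBent)
open SymmetryDialBentBijections (exists_equiv_shift_bent exists_equiv_hyp_of_walsh_eq exists_equiv_point
  exists_equiv_colour exists_equiv_colour₂ exists_equiv_colour₃ exists_equiv_dual_bent dual_zero_eq
  wt_dual_eq dual_eq_iff_walsh_eq)

variable {d : ℕ}

/-- The universe of the affine matrix structure: points `⊕` duals. -/
abbrev U (d : ℕ) : Type := V d ⊕ V d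

/-- Positions of the `3`-pebble game on `𝔄(M_f)`, `𝔄(M_g)`. -/
abbrev Pos (d : ℕ) : Type := PebblePosition 3 (U d) (U d)

section Game

variable (f g fd gd : V d → Bool)

/-! ### 1. The position invariant -/

/-- **Duplicator's invariant** on a position of the `3`-pebble game. -/
structure Inv (p : Pos d) : Prop where
  /-- pebbled pairs are sort-homogeneous -/
  sort : ∀ i u v, p i = some (u, v) →
    (∃ a a' : V d, u = .inl a ∧ v = .inl a') ∨ (∃ θ θ' : V d, u = .inr θ ∧ v = .inr θ')
  /-- a pebbled dual pair has equal dual values and respects the zero dual -/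
  dual : ∀ i (θ θ' : V d), p i = some (.inr θ, .inr θ') → fd θ = gd θ' ∧ (θ = 0 ↔ θ' = 0)
  /-- pebbled pairs respect equality -/
  eq : ∀ i j u v u' v', p i = some (u, v) → p j = some (u', v') → (u = u' ↔ v = v')
  /-- two pebbled point pairs respect the matrix: `f(a+b) = g(a'+b')` -/
  mat : ∀ i j (a a' b b' : V d), p i = some (.inl a, .inl a') → p j = some (.inl b, .inl b') →
    f (a + b) = g (a' + b')
  /-- a pebbled dual pair and two pebbled point pairs respect incidence -/
  inc : ∀ i j l (θ θ' a a' b b' : V d), p i = some (.inr θ, .inr θ') → p j = some (.inl a, .inl a') →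
    p l = some (.inl b, .inl b') → (pair θ (a + b) = 0 ↔ pair θ' (a' + b') = 0)

/-- Duplicator's positions. -/
def positions : Set (Pos d) := {p | Inv f g fd gd p}

variable {f g fd gd}

/-- The empty position is invariant. -/
theorem inv_empty : Inv f g fd gd (PebblePosition.empty : Pos d) := by
  refine ⟨?_, ?_, ?_, ?_, ?_⟩ <;> intros <;> simp_all [PebblePosition.empty]

/-- `pair θ 0 = 0`-type triviality: `θ(a + a) = 0`. -/
theorem pair_add_self (θ a : V d) : pair θ (a + a) = 0 := by
  rw [SymmetryDialPerCongruence.two_nsmul_eq_zero, SymmetryDialTranslationOrbits.pair_zero_right]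

/-- **Updating an invariant position**: if `eP` (points) and `eD` (duals) send the remaining pebbled
elements to their partners and preserve colours / incidences relative to them, and `eD` preserves dual
values and fixes `0`, then placing pair `i` on `(x, (eP ⊕ eD) x)` keeps the invariant, for every `x`. -/
theorem inv_update {p : Pos d} (hp : Inv f g fd gd p) (h0 : f 0 = g 0) (i : Fin 3)
    (eP eD : V d ≃ V d)
    (R1 : ∀ j, j ≠ i → ∀ b b' : V d, p j = some (.inl b, .inl b') → eP b = b')
    (R2 : ∀ j, j ≠ i → ∀ b b' : V d, p j = some (.inl b, .inl b') → ∀ c, f (c + b) = g (eP c + b'))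
    (R3 : ∀ j, j ≠ i → ∀ l, l ≠ i → ∀ θ θ' b b' : V d, p j = some (.inr θ, .inr θ') →
      p l = some (.inl b, .inl b') → ∀ c, (pair θ (c + b) = 0 ↔ pair θ' (eP c + b') = 0))
    (D1 : ∀ j, j ≠ i → ∀ θ θ' : V d, p j = some (.inr θ, .inr θ') → eD θ = θ')
    (D2 : ∀ η, fd η = gd (eD η)) (D4 : eD 0 = 0)
    (D3 : ∀ j, j ≠ i → ∀ l, l ≠ i → ∀ a a' b b' : V d, p j = some (.inl a, .inl a') →
      p l = some (.inl b, .inl b') → ∀ η, (pair η (a + b) = 0 ↔ pair (eD η) (a' + b') = 0))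
    (x : U d) :
    Inv f g fd gd (Function.update p i (some (x, (Equiv.sumCongr eP eD) x))) := by
  -- reading the updated position
  have rd : ∀ j w, Function.update p i (some (x, (Equiv.sumCongr eP eD) x)) j = some w →
      (j = i ∧ w = (x, (Equiv.sumCongr eP eD) x)) ∨ (j ≠ i ∧ p j = some w) := by
    intro j w hj
    by_cases hji : j = i
    · subst hji; rw [Function.update_self] at hj; exact Or.inl ⟨rfl, (Option.some_injective _ hj).symm⟩
    · rw [Function.update_of_ne hji] at hj; exact Or.inr ⟨hji, hj⟩
  -- the image of an old pebbled element under `eP ⊕ eD` is its partner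
  have old : ∀ j, j ≠ i → ∀ u v, p j = some (u, v) → (Equiv.sumCongr eP eD) u = v := by
    intro j hj u v hjuv
    rcases hp.sort j u v hjuv with ⟨a, a', rfl, rfl⟩ | ⟨θ, θ', rfl, rfl⟩
    · simp [R1 j hj a a' hjuv]
    · simp [D1 j hj θ θ' hjuv]
  refine ⟨?_, ?_, ?_, ?_, ?_⟩
  · -- sort
    intro j u v hj
    rcases rd j _ hj with ⟨-, hw⟩ | ⟨hji, hw⟩
    · cases hw
      rcases x with a | θ
      · exact Or.inl ⟨a, eP a, rfl, rfl⟩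
      · exact Or.inr ⟨θ, eD θ, rfl, rfl⟩
    · exact hp.sort j u v hw
  · -- dual
    intro j θ θ' hj
    rcases rd j _ hj with ⟨-, hw⟩ | ⟨hji, hw⟩
    · rcases x with a | η
      · simp at hw
      · simp only [Prod.mk.injEq, Sum.inr.injEq, Equiv.sumCongr_apply, Sum.map_inr] at hw
        obtain ⟨rfl, rfl⟩ := hw
        refine ⟨D2 _, ⟨fun h => by rw [h, D4], fun h => eD.injective (by rw [h, D4])⟩⟩
    · exact hp.dual j θ θ' hw
  · -- eq
    intro j l u v u' v' hj hl
    rcases rd j _ hj with ⟨-, hw⟩ | ⟨hji, hw⟩ <;> rcases rd l _ hl with ⟨-, hw'⟩ | ⟨hli, hw'⟩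
    · cases hw; cases hw'; simp
    · cases hw
      have ho := old l hli u' v' hw'
      constructor
      · rintro rfl; exact ho
      · intro h; rw [← ho] at h; exact (Equiv.sumCongr eP eD).injective h
    · cases hw'
      have ho := old j hji u v hw
      constructor
      · rintro rfl; exact ho.symm
      · intro h; rw [← ho] at h; exact (Equiv.sumCongr eP eD).injective h
    · exact hp.eq j l u v u' v' hw hw'
  · -- mat
    intro j l a a' b b' hj hl
    rcases rd j _ hj with ⟨-, hw⟩ | ⟨hji, hw⟩ <;> rcases rd l _ hl with ⟨-, hw'⟩ | ⟨hli, hw'⟩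
    · rcases x with c | η
      · simp only [Prod.mk.injEq, Sum.inl.injEq, Equiv.sumCongr_apply, Sum.map_inl] at hw hw'
        obtain ⟨rfl, rfl⟩ := hw; obtain ⟨rfl, rfl⟩ := hw'
        rw [SymmetryDialPerCongruence.two_nsmul_eq_zero, SymmetryDialPerCongruence.two_nsmul_eq_zero, h0]
      · simp at hw
    · rcases x with c | η
      · simp only [Prod.mk.injEq, Sum.inl.injEq, Equiv.sumCongr_apply, Sum.map_inl] at hw
        obtain ⟨rfl, rfl⟩ := hw
        exact R2 l hli b b' hw' _
      · simp at hw
    · rcases x with c | η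
      · simp only [Prod.mk.injEq, Sum.inl.injEq, Equiv.sumCongr_apply, Sum.map_inl] at hw'
        obtain ⟨rfl, rfl⟩ := hw'
        rw [add_comm a, add_comm a']
        exact R2 j hji a a' hw _
      · simp at hw'
    · exact hp.mat j l a a' b b' hw hw'
  · -- inc
    intro j l m θ θ' a a' b b' hj hl hm
    rcases rd j _ hj with ⟨-, hw⟩ | ⟨hji, hw⟩
    · -- the dual slot carries the new pebble: `x` is a dual
      rcases x with c | η
      · simp at hw
      simp only [Prod.mk.injEq, Sum.inr.injEq, Equiv.sumCongr_apply, Sum.map_inr] at hw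
      obtain ⟨rfl, rfl⟩ := hw
      rcases rd l _ hl with ⟨-, hw'⟩ | ⟨hli, hw'⟩
      · simp at hw'
      rcases rd m _ hm with ⟨-, hw''⟩ | ⟨hmi, hw''⟩
      · simp at hw''
      exact D3 l hli m hmi a a' b b' hw' hw'' _
    · rcases rd l _ hl with ⟨-, hw'⟩ | ⟨hli, hw'⟩ <;> rcases rd m _ hm with ⟨-, hw''⟩ | ⟨hmi, hw''⟩
      · rcases x with c | η
        · simp only [Prod.mk.injEq, Sum.inl.injEq, Equiv.sumCongr_apply, Sum.map_inl] at hw' hw''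
          obtain ⟨rfl, rfl⟩ := hw'; obtain ⟨rfl, rfl⟩ := hw''
          rw [pair_add_self, pair_add_self]
        · simp at hw'
      · rcases x with c | η
        · simp only [Prod.mk.injEq, Sum.inl.injEq, Equiv.sumCongr_apply, Sum.map_inl] at hw'
          obtain ⟨rfl, rfl⟩ := hw'
          exact R3 j hji m hmi θ θ' b b' hw hw'' _
        · simp at hw'
      · rcases x with c | η
        · simp only [Prod.mk.injEq, Sum.inl.injEq, Equiv.sumCongr_apply, Sum.map_inl] at hw''
          obtain ⟨rfl, rfl⟩ := hw''
          rw [add_comm a, add_comm a']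
          exact R3 j hji l hli θ θ' a a' hw hw' _
        · simp at hw''
      · exact hp.inc j l m θ θ' a a' b b' hw hw' hw''

/-- `Fin 3` bookkeeping: off a given index there are at most two others. -/
theorem fin3_cover {i j l m : Fin 3} (hj : j ≠ i) (hl : l ≠ i) (hjl : j ≠ l) (hm : m ≠ i) :
    m = j ∨ m = l := by
  revert i j l m; decide

/-! ### 2. Duplicator's move -/

/-- **Duplicator's move**: from an invariant position, whichever pair `i` Spoiler lifts, one bijection
keeps the invariant wherever Spoiler places the pair (a colour-preserving bijection with prescribed
values on each sort, chosen by the sorts of the pebble pairs left on the board). -/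
theorem move_mem (hf : IsBent f) (hg : IsBent g) (hfd : ∀ ξ, walsh f ξ = 2 ^ (d / 2) * sgn fd ξ)
    (hgd : ∀ ξ, walsh g ξ = 2 ^ (d / 2) * sgn gd ξ) (hwt : wt f = wt g) (h0 : f 0 = g 0) {p : Pos d}
    (hp : Inv f g fd gd p) (i : Fin 3) :
    ∃ E : U d ≃ U d, ∀ x, Inv f g fd gd (Function.update p i (some (x, E x))) := by
  classical
  have hfd0 : fd 0 = gd 0 := dual_zero_eq hfd hgd hwt
  have hwtd : wt fd = wt gd := wt_dual_eq hf hg hfd hgd h0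
  have zero_iff : ∀ m (θ θ' : V d), p m = some (.inr θ, .inr θ') → (θ = 0 ↔ θ' = 0) :=
    fun m θ θ' h => (hp.dual m θ θ' h).2
  -- it suffices to produce the two sort-wise bijections with the properties of `inv_update`
  suffices H : ∃ eP eD : V d ≃ V d,
      (∀ j, j ≠ i → ∀ b b' : V d, p j = some (.inl b, .inl b') → eP b = b') ∧
      (∀ j, j ≠ i → ∀ b b' : V d, p j = some (.inl b, .inl b') → ∀ c, f (c + b) = g (eP c + b')) ∧
      (∀ j, j ≠ i → ∀ l, l ≠ i → ∀ θ θ' b b' : V d, p j = some (.inr θ, .inr θ') →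
        p l = some (.inl b, .inl b') → ∀ c, (pair θ (c + b) = 0 ↔ pair θ' (eP c + b') = 0)) ∧
      (∀ j, j ≠ i → ∀ θ θ' : V d, p j = some (.inr θ, .inr θ') → eD θ = θ') ∧
      (∀ η, fd η = gd (eD η)) ∧ eD 0 = 0 ∧
      (∀ j, j ≠ i → ∀ l, l ≠ i → ∀ a a' b b' : V d, p j = some (.inl a, .inl a') →
        p l = some (.inl b, .inl b') → ∀ η, (pair η (a + b) = 0 ↔ pair (eD η) (a' + b') = 0)) by
    obtain ⟨eP, eD, R1, R2, R3, D1, D2, D4, D3⟩ := H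
    exact ⟨Equiv.sumCongr eP eD, inv_update hp h0 i eP eD R1 R2 R3 D1 D2 D4 D3⟩
  by_cases hA : ∃ j l, ∃ a a' b b' : V d, j ≠ i ∧ l ≠ i ∧ p j = some (.inl a, .inl a') ∧
      p l = some (.inl b, .inl b') ∧ a ≠ b
  · -- CASE A: two pebbled point pairs with distinct points (then nothing else is on the board)
    obtain ⟨j, l, a, a', b, b', hj, hl, hja, hlb, hab⟩ := hA
    have hjl : j ≠ l := by rintro rfl; rw [hja] at hlb; cases hlb; exact hab rfl
    have ha'b' : a' ≠ b' := fun h =>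
      hab (Sum.inl_injective ((hp.eq j l _ _ _ _ hja hlb).2 (by rw [h])))
    have hu : a + b ≠ 0 := fun h => hab ((SymmetryDialWalsh.add_eq_zero_iff a b).1 h).symm
    have hu' : a' + b' ≠ 0 := fun h => ha'b' ((SymmetryDialWalsh.add_eq_zero_iff a' b').1 h).symm
    have hval : f (a + b) = g (a' + b') := hp.mat j l a a' b b' hja hlb
    obtain ⟨eP, hePa, hePb, heP⟩ := exists_equiv_shift_bent hf hg hu hu' hwt h0 hval a a'
    have hab_u : a + (a + b) = b := by rw [← add_assoc, SymmetryDialPerCongruence.two_nsmul_eq_zero, zero_add]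
    have hab_u' : a' + (a' + b') = b' := by
      rw [← add_assoc, SymmetryDialPerCongruence.two_nsmul_eq_zero, zero_add]
    rw [hab_u, hab_u'] at hePb
    simp_rw [hab_u, hab_u'] at heP
    obtain ⟨eD, heD0, heD⟩ := exists_equiv_dual_bent hf hg hfd hgd hu hu' hwt h0 hval
    have cover : ∀ m, m ≠ i → m = j ∨ m = l := fun m hm => fin3_cover hj hl hjl hm
    have rdP : ∀ m, m ≠ i → ∀ c c' : V d, p m = some (.inl c, .inl c') →
        (c = a ∧ c' = a') ∨ (c = b ∧ c' = b') := by
      intro m hm c c' hmc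
      rcases cover m hm with rfl | rfl
      · rw [hja] at hmc; cases hmc; exact Or.inl ⟨rfl, rfl⟩
      · rw [hlb] at hmc; cases hmc; exact Or.inr ⟨rfl, rfl⟩
    have noD : ∀ m, m ≠ i → ∀ θ θ' : V d, p m ≠ some (.inr θ, .inr θ') := by
      intro m hm θ θ' hmθ
      rcases cover m hm with rfl | rfl
      · rw [hja] at hmθ; cases hmθ
      · rw [hlb] at hmθ; cases hmθ
    refine ⟨eP, eD, ?_, ?_, ?_, ?_, fun η => (heD η).1, heD0, ?_⟩
    · intro m hm c c' hmc
      rcases rdP m hm c c' hmc with ⟨hc, hc'⟩ | ⟨hc, hc'⟩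
      · rw [hc, hc']; exact hePa
      · rw [hc, hc']; exact hePb
    · intro m hm c c' hmc x
      rcases rdP m hm c c' hmc with ⟨hc, hc'⟩ | ⟨hc, hc'⟩
      · rw [hc, hc', add_comm x a, add_comm (eP x) a']; exact (heP x).1
      · rw [hc, hc', add_comm x b, add_comm (eP x) b']; exact (heP x).2
    · intro m hm n _ θ θ' c c' hmθ _ _; exact absurd hmθ (noD m hm θ θ')
    · intro m hm θ θ' hmθ; exact absurd hmθ (noD m hm θ θ')
    · intro m hm n hn c c' e e' hmc hne η
      rcases rdP m hm c c' hmc with ⟨hc, hc'⟩ | ⟨hc, hc'⟩ <;>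
        rcases rdP n hn e e' hne with ⟨he, he'⟩ | ⟨he, he'⟩ <;> rw [hc, hc', he, he']
      · rw [pair_add_self, pair_add_self]
      · exact (heD η).2
      · rw [add_comm b a, add_comm b' a']; exact (heD η).2
      · rw [pair_add_self, pair_add_self]
  -- not case A: all pebbled point pairs off `i` carry the same pair
  by_cases hB : ∃ j, ∃ b b' : V d, j ≠ i ∧ p j = some (.inl b, .inl b')
  · obtain ⟨j, b, b', hj, hjb⟩ := hB
    have samept : ∀ m, m ≠ i → ∀ c c' : V d, p m = some (.inl c, .inl c') → c = b ∧ c' = b' := by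
      intro m hm c c' hmc
      have hcb : c = b := by
        by_contra hne; exact hA ⟨m, j, c, c', b, b', hm, hj, hmc, hjb, hne⟩
      exact ⟨hcb, Sum.inl_injective ((hp.eq m j _ _ _ _ hmc hjb).1 (by rw [hcb]))⟩
    have D3triv : ∀ (eD : V d ≃ V d), ∀ m, m ≠ i → ∀ n, n ≠ i → ∀ c c' e e' : V d,
        p m = some (.inl c, .inl c') → p n = some (.inl e, .inl e') →
        ∀ η, (pair η (c + e) = 0 ↔ pair (eD η) (c' + e') = 0) := by
      intro eD m hm n hn c c' e e' hmc hne η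
      obtain ⟨hc, hc'⟩ := samept m hm c c' hmc
      obtain ⟨he, he'⟩ := samept n hn e e' hne
      rw [hc, hc', he, he', pair_add_self, pair_add_self]
    by_cases hC : ∃ l, ∃ θ θ' : V d, l ≠ i ∧ p l = some (.inr θ, .inr θ') ∧ θ ≠ 0
    · -- CASE B∧C: one pebbled point pair `b ↦ b'` and one pebbled non-zero dual pair `θ ↦ θ'`
      obtain ⟨l, θ, θ', hl, hlθ, hθ⟩ := hC
      have hθ' : θ' ≠ 0 := fun h => hθ ((zero_iff l θ θ' hlθ).2 h)
      have hdv : fd θ = gd θ' := (hp.dual l θ θ' hlθ).1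
      have hW : walsh f θ = walsh g θ' := (dual_eq_iff_walsh_eq hfd hgd θ θ').1 hdv
      have hjl : j ≠ l := by rintro rfl; rw [hjb] at hlθ; cases hlθ
      have cover : ∀ m, m ≠ i → m = j ∨ m = l := fun m hm => fin3_cover hj hl hjl hm
      have rdD : ∀ m, m ≠ i → ∀ ζ ζ' : V d, p m = some (.inr ζ, .inr ζ') → ζ = θ ∧ ζ' = θ' := by
        intro m hm ζ ζ' hmζ
        rcases cover m hm with rfl | rfl
        · rw [hjb] at hmζ; cases hmζ
        · rw [hlθ] at hmζ; cases hmζ; exact ⟨rfl, rfl⟩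
      obtain ⟨eP, hePb, heP⟩ := exists_equiv_hyp_of_walsh_eq f g hθ hθ' hwt hW h0 b b'
      obtain ⟨eD, heD0, heDθ, heD⟩ := exists_equiv_colour₂ fd gd hwtd (θ₁ := 0) (θ₂ := θ)
        (θ₁' := 0) (θ₂' := θ') (Ne.symm hθ) (Ne.symm hθ') hfd0 hdv
      refine ⟨eP, eD, ?_, ?_, ?_, ?_, heD, heD0, D3triv eD⟩
      · intro m hm c c' hmc
        obtain ⟨hc, hc'⟩ := samept m hm c c' hmc; rw [hc, hc']; exact hePb
      · intro m hm c c' hmc x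
        obtain ⟨hc, hc'⟩ := samept m hm c c' hmc
        rw [hc, hc', add_comm x b, add_comm (eP x) b']; exact (heP x).1
      · intro m hm n hn ζ ζ' c c' hmζ hnc x
        obtain ⟨hζ, hζ'⟩ := rdD m hm ζ ζ' hmζ
        obtain ⟨hc, hc'⟩ := samept n hn c c' hnc
        rw [hζ, hζ', hc, hc', add_comm x b, add_comm (eP x) b']; exact (heP x).2
      · intro m hm ζ ζ' hmζ
        obtain ⟨hζ, hζ'⟩ := rdD m hm ζ ζ' hmζ; rw [hζ, hζ']; exact heDθ
    · -- CASE B∧¬C: one pebbled point pair, every pebbled dual pair is the zero pair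
      have zeroD : ∀ m, m ≠ i → ∀ ζ ζ' : V d, p m = some (.inr ζ, .inr ζ') → ζ = 0 ∧ ζ' = 0 := by
        intro m hm ζ ζ' hmζ
        have hζ : ζ = 0 := by by_contra hne; exact hC ⟨m, ζ, ζ', hm, hmζ, hne⟩
        exact ⟨hζ, (zero_iff m ζ ζ' hmζ).1 hζ⟩
      obtain ⟨eP, hePb, heP⟩ := exists_equiv_point f g hwt h0 b b'
      obtain ⟨eD, heD0, heD⟩ := exists_equiv_colour fd gd hwtd (θ := 0) (θ' := 0) hfd0
      refine ⟨eP, eD, ?_, ?_, ?_, ?_, heD, heD0, D3triv eD⟩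
      · intro m hm c c' hmc
        obtain ⟨hc, hc'⟩ := samept m hm c c' hmc; rw [hc, hc']; exact hePb
      · intro m hm c c' hmc x
        obtain ⟨hc, hc'⟩ := samept m hm c c' hmc
        rw [hc, hc', add_comm x b, add_comm (eP x) b']; exact heP x
      · intro m hm n hn ζ ζ' c c' hmζ _ x
        obtain ⟨hζ, hζ'⟩ := zeroD m hm ζ ζ' hmζ
        rw [hζ, hζ', SymmetryDialTranslationOrbits.pair_zero_left,
          SymmetryDialTranslationOrbits.pair_zero_left]
      · intro m hm ζ ζ' hmζ
        obtain ⟨hζ, hζ'⟩ := zeroD m hm ζ ζ' hmζ; rw [hζ, hζ']; exact heD0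
  · -- CASE ¬B: no pebbled point pair off `i`; the points are answered by the identity
    have noP : ∀ m, m ≠ i → ∀ c c' : V d, p m ≠ some (.inl c, .inl c') :=
      fun m hm c c' hmc => hB ⟨m, c, c', hm, hmc⟩
    have Ptriv : ∀ eD : V d ≃ V d, (∀ j, j ≠ i → ∀ θ θ' : V d, p j = some (.inr θ, .inr θ') → eD θ = θ') →
        (∀ η, fd η = gd (eD η)) → eD 0 = 0 → ∃ eP eD : V d ≃ V d,
        (∀ j, j ≠ i → ∀ b b' : V d, p j = some (.inl b, .inl b') → eP b = b') ∧
        (∀ j, j ≠ i → ∀ b b' : V d, p j = some (.inl b, .inl b') → ∀ c, f (c + b) = g (eP c + b')) ∧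
        (∀ j, j ≠ i → ∀ l, l ≠ i → ∀ θ θ' b b' : V d, p j = some (.inr θ, .inr θ') →
          p l = some (.inl b, .inl b') → ∀ c, (pair θ (c + b) = 0 ↔ pair θ' (eP c + b') = 0)) ∧
        (∀ j, j ≠ i → ∀ θ θ' : V d, p j = some (.inr θ, .inr θ') → eD θ = θ') ∧
        (∀ η, fd η = gd (eD η)) ∧ eD 0 = 0 ∧
        (∀ j, j ≠ i → ∀ l, l ≠ i → ∀ a a' b b' : V d, p j = some (.inl a, .inl a') →
          p l = some (.inl b, .inl b') → ∀ η, (pair η (a + b) = 0 ↔ pair (eD η) (a' + b') = 0)) :=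
      fun eD D1 D2 D4 => ⟨Equiv.refl _, eD, fun m hm c c' hmc => absurd hmc (noP m hm c c'),
        fun m hm c c' hmc => absurd hmc (noP m hm c c'),
        fun m hm n hn θ θ' c c' _ hnc => absurd hnc (noP n hn c c'), D1, D2, D4,
        fun m hm n hn c c' e e' hmc => absurd hmc (noP m hm c c')⟩
    by_cases hD : ∃ j l, ∃ θ θ' ζ ζ' : V d, j ≠ i ∧ l ≠ i ∧ p j = some (.inr θ, .inr θ') ∧
        p l = some (.inr ζ, .inr ζ') ∧ θ ≠ ζ ∧ θ ≠ 0 ∧ ζ ≠ 0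
    · -- two distinct non-zero pebbled duals: three prescribed values `0, θ, ζ`
      obtain ⟨j, l, θ, θ', ζ, ζ', hj, hl, hjθ, hlζ, hθζ, hθ, hζ⟩ := hD
      have hθ' : θ' ≠ 0 := fun h => hθ ((zero_iff j θ θ' hjθ).2 h)
      have hζ' : ζ' ≠ 0 := fun h => hζ ((zero_iff l ζ ζ' hlζ).2 h)
      have hθζ' : θ' ≠ ζ' := fun h =>
        hθζ (Sum.inr_injective ((hp.eq j l _ _ _ _ hjθ hlζ).2 (by rw [h])))
      have hjl : j ≠ l := by rintro rfl; rw [hjθ] at hlζ; cases hlζ; exact hθζ rfl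
      have cover : ∀ m, m ≠ i → m = j ∨ m = l := fun m hm => fin3_cover hj hl hjl hm
      obtain ⟨eD, heD0, heDθ, heDζ, heD⟩ := exists_equiv_colour₃ fd gd hwtd (θ₁ := 0) (θ₂ := θ)
        (θ₃ := ζ) (θ₁' := 0) (θ₂' := θ') (θ₃' := ζ') (Ne.symm hθ) (Ne.symm hζ) hθζ (Ne.symm hθ')
        (Ne.symm hζ') hθζ' hfd0 (hp.dual j θ θ' hjθ).1 (hp.dual l ζ ζ' hlζ).1
      refine Ptriv eD ?_ heD heD0
      intro m hm η η' hmη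
      rcases cover m hm with rfl | rfl
      · rw [hjθ] at hmη; cases hmη; exact heDθ
      · rw [hlζ] at hmη; cases hmη; exact heDζ
    by_cases hE : ∃ j, ∃ θ θ' : V d, j ≠ i ∧ p j = some (.inr θ, .inr θ') ∧ θ ≠ 0
    · -- exactly one non-zero pebbled dual value `θ ↦ θ'` (possibly on two pairs): prescribe `0, θ`
      obtain ⟨j, θ, θ', hj, hjθ, hθ⟩ := hE
      have hθ' : θ' ≠ 0 := fun h => hθ ((zero_iff j θ θ' hjθ).2 h)
      have hdv : fd θ = gd θ' := (hp.dual j θ θ' hjθ).1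
      obtain ⟨eD, heD0, heDθ, heD⟩ := exists_equiv_colour₂ fd gd hwtd (θ₁ := 0) (θ₂ := θ)
        (θ₁' := 0) (θ₂' := θ') (Ne.symm hθ) (Ne.symm hθ') hfd0 hdv
      refine Ptriv eD ?_ heD heD0
      intro m hm η η' hmη
      by_cases hη : η = 0
      · subst hη; rw [(zero_iff m 0 η' hmη).1 rfl]; exact heD0
      · have hηθ : η = θ := by
          by_contra hne; exact hD ⟨m, j, η, η', θ, θ', hm, hj, hmη, hjθ, hne, hη, hθ⟩
        subst hηθ
        have : η' = θ' := Sum.inr_injective ((hp.eq m j _ _ _ _ hmη hjθ).1 rfl)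
        subst this; exact heDθ
    · -- every pebbled dual pair off `i` is the zero pair
      obtain ⟨eD, heD0, heD⟩ := exists_equiv_colour fd gd hwtd (θ := 0) (θ' := 0) hfd0
      refine Ptriv eD ?_ heD heD0
      intro m hm η η' hmη
      have hη : η = 0 := by by_contra hne; exact hE ⟨m, η, η', hm, hmη, hne⟩
      subst hη; rw [(zero_iff m 0 η' hmη).1 rfl]; exact heD0

/-- **Duplicator's strategy space** for bent `f, g` with `wt f = wt g`, `f 0 = g 0`. -/
def strategy (hf : IsBent f) (hg : IsBent g) (hfd : ∀ ξ, walsh f ξ = 2 ^ (d / 2) * sgn fd ξ)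
    (hgd : ∀ ξ, walsh g ξ = 2 ^ (d / 2) * sgn gd ξ) (hwt : wt f = wt g) (h0 : f 0 = g 0) :
    PebbleStrategySpace 3 (U d) (U d) where
  positions := positions f g fd gd
  empty_mem := inv_empty
  move := fun _ hp i => move_mem hf hg hfd hgd hwt h0 hp i

end Game

end Summit.ValiantsHypothesis.ValiantsHypothesis.Theorems.SymmetryDialBentGame
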